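import Literature.AnabelianGeometry.SemiGraphs.TemperedEdgeInVerticialProofs
import Literature.AnabelianGeometry.SemiGraphs.TemperedReconstructionReductionsProofs
import Literature.AnabelianGeometry.SemiGraphs.TemperoidsResProofs
import HarnessLib

/-!
# [SemiAnbd] Theorem 3.7 (i)/(iii) vocabulary: edge-like subgroups are the images of the branch
# groups under the verticial homomorphisms — proofs

Mochizuki, *Semi-graphs of anabelioids*, Publ. RIMS **42** (2006), §3, manuscript pp. 40–41
[cite: MochizukiSemiAnbd2006, Thm 3.7(iii) p.41]: the edge-like subgroups are "the images of the
`π̂₁(G_e)`" in `π₁^temp(G)`; the branch `b` of `e` abutting to `v` gives `Π_e → Π_v` (`b_*`, p. 23)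
and hence "`π̂₁(G_e) → π̂₁(G_v) → π₁^temp(G)`".  In the local presentation
(`TemperedCoverings.lean`: `restrictV`, `restrictE`, the gluings `S_e ≅ b^* S_v`, `verticialSubgroups`,
`edgeLikeSubgroups`; `TemperedVerticial.lean`: `IsVerticialHom`, `IsEdgeHom`) this reads:

* (the gluings assemble into a natural isomorphism `restrictE e ≅ restrictV v ⋙ B^temp(b_*)`:
  `nonempty_restrictE_iso_restrictV_res` of `TemperedEdgeInVerticialProofs.lean`, seat abc-iut-L3-t11,
  which also proves that edge-like subgroups are conjugate INTO verticial ones);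
* (if `ψ : Π_v → π₁^temp(G)` is verticial then `ψ ∘ b_*` is an edge homomorphism at `e`:
  `isEdgeHom_comp_brHom` of `TemperedReconstructionReductionsProofs.lean`); hence
  (`map_branchSubgroup_mem_edgeLikeSubgroups`) `ψ(Π_b)` is edge-like;
* `exists_eq_map_branchSubgroup_of_mem_edgeLikeSubgroups` — conversely (Prop. 3.2, injectivity
  half: `BTemp.exists_conj_of_natTrans`), once `v` carries a verticial homomorphism, EVERY edge-like
  subgroup at `e` is EXACTLY `ψ(Π_b)` for a verticial `ψ` at `v` (sharpening the conjugate-inclusion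
  of loc. cit.), and `edgeLikeSubgroups_nonempty_of`.
Proof-only; no statement of the paper is strengthened; nothing here takes a side on any disputed step.
-/

open CategoryTheory Topology

namespace Literature.AnabelianGeometry.SemiGraphs

namespace ProfiniteSemiGraph

universe u

variable {𝒢 : ProfiniteSemiGraph.{u}}

/-- The image `ψ(Π_b)` of the branch group under a verticial homomorphism is an edge-like
subgroup at `e`. [cite: MochizukiSemiAnbd2006, Thm 3.7(iii) p.41] -/
theorem map_branchSubgroup_mem_edgeLikeSubgroups (c : TemperedPiChart 𝒢) (b : 𝒢.graph.Branch)
    (v : 𝒢.graph.Vertex) (h : 𝒢.graph.abuts b = some v) {ψ : 𝒢.Gv v →ₜ* c.G}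
    (hψ : IsVerticialHom c v ψ) :
    (𝒢.branchSubgroup b v h).map ψ.toMonoidHom ∈ edgeLikeSubgroups c (𝒢.graph.edgeOf b) := by
  refine ⟨ψ.comp (𝒢.brHom b v h), isEdgeHom_comp_brHom c h hψ, ?_⟩
  rw [branchSubgroup, ← MonoidHom.range_comp]
  rfl

/-- **Every edge-like subgroup is the image of the branch group under a verticial homomorphism**
(for a branch `b` of `e` abutting to a vertex `v` carrying some verticial homomorphism; Prop. 3.2,
injectivity half, `BTemp.exists_conj_of_natTrans`): `L = ψ(Π_b)` with `ψ` verticial at `v`.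
[cite: MochizukiSemiAnbd2006, Thm 3.7(iii) p.41] -/
theorem exists_eq_map_branchSubgroup_of_mem_edgeLikeSubgroups (c : TemperedPiChart 𝒢)
    (b : 𝒢.graph.Branch) (v : 𝒢.graph.Vertex) (h : 𝒢.graph.abuts b = some v)
    (hex : ∃ ψ : 𝒢.Gv v →ₜ* c.G, IsVerticialHom c v ψ) {L : Subgroup c.G}
    (hL : L ∈ edgeLikeSubgroups c (𝒢.graph.edgeOf b)) :
    ∃ ψ : 𝒢.Gv v →ₜ* c.G, IsVerticialHom c v ψ ∧ L = (𝒢.branchSubgroup b v h).map ψ.toMonoidHom := by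
  obtain ⟨ψ₀, hψ₀⟩ := hex
  obtain ⟨φ, ⟨i⟩, rfl⟩ := hL
  obtain ⟨j⟩ := isEdgeHom_comp_brHom c h hψ₀
  -- `B^temp(ψ₀ ∘ b_*) ≅ B^temp(φ)`, so `φ = γ_g ∘ ψ₀ ∘ b_*`
  obtain ⟨g, hg, -⟩ :=
    BTemp.exists_conj_of_natTrans c.isTempered (ψ₀.comp (𝒢.brHom b v h)) φ (j.symm ≪≫ i).hom
  -- `ψ := γ_g ∘ ψ₀` is verticial
  let ψ : 𝒢.Gv v →ₜ* c.G :=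
    { toMonoidHom := (MulAut.conj g).toMonoidHom.comp ψ₀.toMonoidHom
      continuous_toFun := by
        exact ((continuous_const.mul continuous_id).mul continuous_const).comp ψ₀.continuous }
  have hgψ : ∀ a, g * ψ₀ a * g⁻¹ = ψ a := fun a => rfl
  obtain ⟨η₀⟩ := hψ₀
  refine ⟨ψ, ⟨η₀ ≪≫ BTemp.resIsoOfConj ψ₀ ψ g hgψ⟩, ?_⟩
  ext x
  simp only [MonoidHom.mem_range, Subgroup.mem_map, branchSubgroup]
  constructor
  · rintro ⟨a, rfl⟩
    exact ⟨𝒢.brHom b v h a, ⟨a, rfl⟩, show g * ψ₀ (𝒢.brHom b v h a) * g⁻¹ = φ a from hg a⟩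
  · rintro ⟨y, ⟨a, rfl⟩, rfl⟩
    exact ⟨a, show φ a = g * ψ₀ (𝒢.brHom b v h a) * g⁻¹ from (hg a).symm⟩

/-- The edge-like subgroups at an edge with an abutting branch are nonempty as soon as the vertex
carries a verticial homomorphism. [cite: MochizukiSemiAnbd2006, Thm 3.7(iii) p.41] -/
theorem edgeLikeSubgroups_nonempty_of (c : TemperedPiChart 𝒢) (b : 𝒢.graph.Branch)
    (v : 𝒢.graph.Vertex) (h : 𝒢.graph.abuts b = some v)
    (hex : ∃ ψ : 𝒢.Gv v →ₜ* c.G, IsVerticialHom c v ψ) :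
    (edgeLikeSubgroups c (𝒢.graph.edgeOf b)).Nonempty := by
  obtain ⟨ψ, hψ⟩ := hex
  exact ⟨_, map_branchSubgroup_mem_edgeLikeSubgroups c b v h hψ⟩

end ProfiniteSemiGraph

end Literature.AnabelianGeometry.SemiGraphs
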